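import Summits.CriticalPhenomena.PercolationContinuityZ3.Theorems.PercNearOneGluingNoHeavyQuantCatHullLeafSearch
import HarnessLib

/-!
# QUANT lane R8, T-DEC: FROM A TINY-SUPPORT CATERPILLAR LAW TO THE LEAF CHECK — the leaf inequality of `CatValueBoundS` for a sub-law on three
# atoms whose weights are parametrised by a shape, given the bisection check of that shape

builds on p205010 (kernel theorem, internal audit signed; external expert review pending)

Support file (`--supports stmt-CriticalPhenomena-4575`), QUANT lane census seat prim-quant-census-2 (gen 78).  Theorems; standard axioms, no sorries.
`Tab.leaf_core`: if `ν` (nonnegative, mass one, vanishing above `N`) lives on the atoms `h₀,h₁,h₂` of a shape `sh` with weights `sh.wts (y/G) t₁ t₂`,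
the blob gate is `g = y/G + (1 − y/G)·t_g`, all `t ∈ [0,1]`, and `Tab.leafSearchOK sh …` passes for the table `T`, then
`G·((1−g)·offFun ψ N ν u + g·offFun ψ N ν (u+a) − ψ u) ≤ T.Z G (G·(lmean N ν + a·g))` — the `leaf` field of `CatValueBoundS` with `Z u := T.Z`.
`Tab.leaf_three` / `Tab.leaf_two` / `Tab.leaf_one` feed it from the classification regions of `…QuantCatHullTinySupport` (three atoms `{0,1,5}` /
`{1,2,6}`, two atoms `{0,4}`, one atom).  [this work].  Nothing here is cited as a published result.  The gluing rows served
[cite: KozmaNitzan2024, Conjecture 3 (p. 15)]; product measure [cite: Grimmett1999, §1.3 p. 10].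
-/

noncomputable section

open scoped BigOperators

namespace Summit.CriticalPhenomena.PercolationContinuityZ3.Theorems
namespace Quant
namespace LawDec
namespace Tab

open Finset

/-- `offFun` of a law living on three distinct atoms. [this work] -/
theorem offFun_three (ψ : ℕ → ℝ) {N : ℕ} {ν : ℕ → ℝ} (hN : ∀ h, N < h → ν h = 0) {h0 h1 h2 : ℕ} (h01 : h0 ≠ h1) (h02 : h0 ≠ h2)
    (h12 : h1 ≠ h2) (hs : ∀ k, ν k ≠ 0 → k = h0 ∨ k = h1 ∨ k = h2) (v : ℕ) :
    offFun ψ N ν v = ν h0 * ψ (v + h0) + ν h1 * ψ (v + h1) + ν h2 * ψ (v + h2) := by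
  unfold offFun
  rw [law_wsum_supp (fun h => ψ (v + h)) hN (D := {h0, h1, h2}) (fun k hk => by
    rcases hs k hk with rfl | rfl | rfl <;> simp)]
  rw [Finset.sum_insert (by simp [h01, h02]), Finset.sum_insert (by simp [h12]), Finset.sum_singleton]
  ring

/-- mean of a law living on three distinct atoms. [this work] -/
theorem lmean_three {N : ℕ} {ν : ℕ → ℝ} (hN : ∀ h, N < h → ν h = 0) {h0 h1 h2 : ℕ} (h01 : h0 ≠ h1) (h02 : h0 ≠ h2) (h12 : h1 ≠ h2)
    (hs : ∀ k, ν k ≠ 0 → k = h0 ∨ k = h1 ∨ k = h2) :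
    lmean N ν = (h0 : ℝ) * ν h0 + (h1 : ℝ) * ν h1 + (h2 : ℝ) * ν h2 := by
  unfold lmean
  rw [law_wsum_supp (fun h => (h : ℝ)) hN (D := {h0, h1, h2}) (fun k hk => by
    rcases hs k hk with rfl | rfl | rfl <;> simp)]
  rw [Finset.sum_insert (by simp [h01, h02]), Finset.sum_insert (by simp [h12]), Finset.sum_singleton]
  ring

/-- mass of a law living on three distinct atoms. [this work] -/
theorem mass_three {N : ℕ} {ν : ℕ → ℝ} (hN : ∀ h, N < h → ν h = 0) (h1s : ∑ h ∈ Finset.range (N + 1), ν h = 1) {h0 h1 h2 : ℕ}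
    (h01 : h0 ≠ h1) (h02 : h0 ≠ h2) (h12 : h1 ≠ h2) (hs : ∀ k, ν k ≠ 0 → k = h0 ∨ k = h1 ∨ k = h2) :
    ν h0 + ν h1 + ν h2 = 1 := by
  have := law_sum_supp hN (D := {h0, h1, h2}) (fun k hk => by rcases hs k hk with rfl | rfl | rfl <;> simp)
  rw [h1s, Finset.sum_insert (by simp [h01, h02]), Finset.sum_insert (by simp [h12]), Finset.sum_singleton] at this
  linarith

/-- **THE CORE LEAF LEMMA**: a law on the three atoms of a shape, with the shape's weights, satisfies the `leaf` inequality against a table that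
passes the bisection check. [this work] -/
theorem leaf_core (sh : Shape) (ψq : ℕ → ℚ) (y : ℚ) (T : Tab) (fuel : ℕ) (u : ℕ)
    (hchk : leafSearchOK sh (ψq u) (ψq (u + sh.h0)) (ψq (u + sh.h1)) (ψq (u + sh.h2)) (ψq (u + sh.a + sh.h0)) (ψq (u + sh.a + sh.h1))
      (ψq (u + sh.a + sh.h2)) y T fuel = true)
    (hw : T.wf = true) (hgb0 : T.gb.getD 0 0 = y) (hgb1 : T.gb.getLast?.getD 0 = 1)
    (h01 : sh.h0 ≠ sh.h1) (h02 : sh.h0 ≠ sh.h2) (h12 : sh.h1 ≠ sh.h2)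
    {N : ℕ} {ν : ℕ → ℝ} (fN : ∀ h, N < h → ν h = 0)
    (hs : ∀ k, ν k ≠ 0 → k = sh.h0 ∨ k = sh.h1 ∨ k = sh.h2)
    {G g tg t1 t2 : ℝ} (hyG : (y : ℝ) < G) (hG1 : G ≤ 1) (hy : 0 < y)
    (htg : 0 ≤ tg ∧ tg ≤ 1) (ht1 : 0 ≤ t1 ∧ t1 ≤ 1) (ht2 : 0 ≤ t2 ∧ t2 ≤ 1)
    (hg : g = (y : ℝ) / G + (1 - (y : ℝ) / G) * tg)
    (hw0 : ν sh.h0 = (sh.wts ((y : ℝ) / G) t1 t2).1) (hw1 : ν sh.h1 = (sh.wts ((y : ℝ) / G) t1 t2).2.1)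
    (hw2 : ν sh.h2 = (sh.wts ((y : ℝ) / G) t1 t2).2.2)
    (hA : G * (lmean N ν + sh.a * g) ≤ ((T.ab.getLast?.getD 0 : ℚ) : ℝ)) :
    G * ((1 - g) * offFun (fun n => (ψq n : ℝ)) N ν u + g * offFun (fun n => (ψq n : ℝ)) N ν (u + sh.a) - (ψq u : ℝ))
      ≤ T.Z G (G * (lmean N ν + sh.a * g)) := by
  have hG : 0 < G := lt_trans (by exact_mod_cast hy) hyG
  -- the functional and the mean in terms of the shape
  have eoff : ∀ v, offFun (fun n => (ψq n : ℝ)) N ν v = ν sh.h0 * ψq (v + sh.h0) + ν sh.h1 * ψq (v + sh.h1) + ν sh.h2 * ψq (v + sh.h2) :=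
    fun v => offFun_three _ fN h01 h02 h12 hs v
  have emean : lmean N ν = (sh.h0 : ℝ) * ν sh.h0 + (sh.h1 : ℝ) * ν sh.h1 + (sh.h2 : ℝ) * ν sh.h2 := lmean_three fN h01 h02 h12 hs
  set t : Fin 3 → ℝ := ![tg, t1, t2] with htdef
  have ht : ∀ i, 0 ≤ t i ∧ t i ≤ 1 := by
    intro i; fin_cases i
    · simpa [htdef] using htg
    · simpa [htdef] using ht1
    · simpa [htdef] using ht2
  have eL : G * ((1 - g) * offFun (fun n => (ψq n : ℝ)) N ν u + g * offFun (fun n => (ψq n : ℝ)) N ν (u + sh.a) - (ψq u : ℝ))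
      = G * sh.lhsG ((ψq u : ℚ) : ℝ) (ψq (u + sh.h0)) (ψq (u + sh.h1)) (ψq (u + sh.h2)) (ψq (u + sh.a + sh.h0)) (ψq (u + sh.a + sh.h1))
          (ψq (u + sh.a + sh.h2)) ((y : ℝ) / G) (t 0) (t 1) (t 2) := by
    rw [eoff u, eoff (u + sh.a), hw0, hw1, hw2, hg]
    simp only [htdef, Matrix.cons_val_zero, Matrix.cons_val_one, Matrix.head_cons, Matrix.cons_val_two, Matrix.tail_cons]
    unfold Shape.lhsG
    simp only [add_assoc]
  have eA : G * (lmean N ν + sh.a * g) = G * sh.rate ((y : ℝ) / G) (t 0) (t 1) (t 2) := by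
    rw [emean, hw0, hw1, hw2, hg]
    simp only [htdef, Matrix.cons_val_zero, Matrix.cons_val_one, Matrix.head_cons, Matrix.cons_val_two, Matrix.tail_cons]
    unfold Shape.rate
    ring_nf
  rw [eL, eA]
  have hA' : G * sh.rate ((y : ℝ) / G) (t 0) (t 1) (t 2) ≤ ((T.ab.getLast?.getD 0 : ℚ) : ℝ) := by rw [← eA]; exact hA
  exact leafSearchOK_sound hchk hw hG (by rw [hgb0]; exact hyG.le) (by rw [hgb1]; exact_mod_cast hG1) ht hA'


/-- the shape with given blob size, atoms and mode. [this work] -/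
def mkShape (a h0 h1 h2 : ℕ) (m : Mode) : Shape := ⟨a, h0, h1, h2, m⟩

/-- the bisection check for the shape `(a, h0, h1, h2, m)` at offset `u` against table `T` (the `ψ`-values read off `ψq`). [this work] -/
def leafChk (ψq : ℕ → ℚ) (y : ℚ) (T : Tab) (fuel : ℕ) (u a h0 h1 h2 : ℕ) (m : Mode) : Bool :=
  leafSearchOK (mkShape a h0 h1 h2 m) (ψq u) (ψq (u + h0)) (ψq (u + h1)) (ψq (u + h2)) (ψq (u + a + h0)) (ψq (u + a + h1)) (ψq (u + a + h2)) y T fuel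

/-- **THREE ATOMS** (`{h0,h1,h2}` with the region of `catBuilt_supp015` / `catBuilt_supp126`): the `leaf` inequality from the checks of the modes
that can occur. [this work] -/
theorem leaf_three (ψq : ℕ → ℚ) (y : ℚ) (T : Tab) (fuel : ℕ) (u a h0 h1 h2 : ℕ) {N : ℕ} {ν : ℕ → ℝ}
    (hz : leafChk ψq y T fuel u a h0 h1 h2 Mode.zero = true) (hsg : ν h1 ≠ 0 → leafChk ψq y T fuel u a h0 h1 h2 Mode.seg = true)
    (htr : ν h2 ≠ 0 → leafChk ψq y T fuel u a h0 h1 h2 Mode.tri = true)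
    (hw : T.wf = true) (hgb0 : T.gb.getD 0 0 = y) (hgb1 : T.gb.getLast?.getD 0 = 1) (h01 : h0 ≠ h1) (h02 : h0 ≠ h2) (h12 : h1 ≠ h2)
    (f0 : ∀ h, 0 ≤ ν h) (fN : ∀ h, N < h → ν h = 0) (f1 : ∑ h ∈ Finset.range (N + 1), ν h = 1)
    (hs : ∀ k, ν k ≠ 0 → k = h0 ∨ k = h1 ∨ k = h2) {x : ℝ} (hreg : (ν h2 = 0 ∨ x ≤ ν h2) ∧ (ν h2 = 0 → ν h1 = 0 ∨ x ≤ ν h1))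
    {G g : ℝ} (hy : 0 < y) (hyG : (y : ℝ) < G) (hG1 : G ≤ 1) (hGx : (y : ℝ) ≤ G * x) (hx1 : x < 1) (hxg : x ≤ g) (hg1 : g < 1)
    (hA : G * (lmean N ν + a * g) ≤ ((T.ab.getLast?.getD 0 : ℚ) : ℝ)) :
    G * ((1 - g) * offFun (fun n => (ψq n : ℝ)) N ν u + g * offFun (fun n => (ψq n : ℝ)) N ν (u + a) - (ψq u : ℝ))
      ≤ T.Z G (G * (lmean N ν + a * g)) := by
  have hG : 0 < G := lt_trans (by exact_mod_cast hy) hyG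
  have hx0 : 0 < x := by
    by_contra hc; push Not at hc
    have : G * x ≤ 0 := mul_nonpos_of_nonneg_of_nonpos hG.le hc
    have : (0 : ℝ) < y := by exact_mod_cast hy
    linarith
  set x' : ℝ := (y : ℝ) / G with hx'
  have hx'x : x' ≤ x := by rw [hx', div_le_iff₀ hG]; linarith [mul_comm G x]
  have hx'1 : x' < 1 := lt_of_le_of_lt hx'x hx1
  obtain ⟨tg, htg0, htg1, etg⟩ := unitParam hx'1 (hx'x.trans hxg) hg1.le
  have hmass := mass_three fN f1 h01 h02 h12 hs
  have hp1le : ν h1 ≤ 1 := by linarith [f0 h0, f0 h2]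
  have hp2le : ν h2 ≤ 1 := by linarith [f0 h0, f0 h1]
  rcases hreg with ⟨h2z | h2x, himp⟩
  · rcases himp h2z with h1z | h1x
    · -- mode zero: ν = δ_{h0}
      have hw0 : ν h0 = 1 := by linarith
      exact leaf_core (mkShape a h0 h1 h2 Mode.zero) ψq y T fuel u hz hw hgb0 hgb1 h01 h02 h12 fN hs hyG hG1 hy ⟨htg0, htg1⟩
        ⟨le_rfl, zero_le_one⟩ ⟨le_rfl, zero_le_one⟩ etg (by simp [Shape.wts, mkShape, hw0]) (by simp [Shape.wts, mkShape, h1z])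
        (by simp [Shape.wts, mkShape, h2z]) hA
    · -- mode seg: mass x' + (1-x') t1 on h1
      have h1ne : ν h1 ≠ 0 := by intro hc; rw [hc] at h1x; linarith
      obtain ⟨t1, ht10, ht11, et1⟩ := unitParam hx'1 (hx'x.trans h1x) hp1le
      have hw0 : ν h0 = 1 - ν h1 := by linarith
      exact leaf_core (mkShape a h0 h1 h2 Mode.seg) ψq y T fuel u (hsg h1ne) hw hgb0 hgb1 h01 h02 h12 fN hs hyG hG1 hy ⟨htg0, htg1⟩
        ⟨ht10, ht11⟩ ⟨le_rfl, zero_le_one⟩ etg (by simp only [Shape.wts, mkShape]; rw [hw0, et1])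
        (by simp only [Shape.wts, mkShape]; rw [et1]) (by simp [Shape.wts, mkShape, h2z]) hA
  · -- mode tri: mass x' + (1-x') t2 on h2, (1 - p2) t1 on h1
    have h2ne : ν h2 ≠ 0 := by intro hc; rw [hc] at h2x; linarith
    obtain ⟨t2, ht20, ht21, et2⟩ := unitParam hx'1 (hx'x.trans h2x) hp2le
    obtain ⟨t1, ht10, ht11, et1⟩ := unitParam' (f0 h1) (by linarith [f0 h0] : ν h1 + ν h2 ≤ 1) hp2le
    have hw0 : ν h0 = (1 - ν h2) * (1 - t1) := by nlinarith
    exact leaf_core (mkShape a h0 h1 h2 Mode.tri) ψq y T fuel u (htr h2ne) hw hgb0 hgb1 h01 h02 h12 fN hs hyG hG1 hy ⟨htg0, htg1⟩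
      ⟨ht10, ht11⟩ ⟨ht20, ht21⟩ etg (by simp only [Shape.wts, mkShape]; rw [hw0, et2])
      (by simp only [Shape.wts, mkShape]; rw [et1, et2]) (by simp only [Shape.wts, mkShape]; rw [et2]) hA

/-- **TWO ATOMS** `{0,4}` (region of `catBuilt_supp04`; dummy third atom `11`). [this work] -/
theorem leaf_two (ψq : ℕ → ℚ) (y : ℚ) (T : Tab) (fuel : ℕ) (u a : ℕ) {N : ℕ} {ν : ℕ → ℝ}
    (hz : leafChk ψq y T fuel u a 0 4 11 Mode.zero = true) (hsg : leafChk ψq y T fuel u a 0 4 11 Mode.seg = true)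
    (hw : T.wf = true) (hgb0 : T.gb.getD 0 0 = y) (hgb1 : T.gb.getLast?.getD 0 = 1)
    (f0 : ∀ h, 0 ≤ ν h) (fN : ∀ h, N < h → ν h = 0) (f1 : ∑ h ∈ Finset.range (N + 1), ν h = 1)
    (hs : ∀ k, ν k ≠ 0 → k = 0 ∨ k = 4) {x : ℝ} (hreg : ν 4 = 0 ∨ x ≤ ν 4)
    {G g : ℝ} (hy : 0 < y) (hyG : (y : ℝ) < G) (hG1 : G ≤ 1) (hGx : (y : ℝ) ≤ G * x) (hx1 : x < 1) (hxg : x ≤ g) (hg1 : g < 1)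
    (hA : G * (lmean N ν + a * g) ≤ ((T.ab.getLast?.getD 0 : ℚ) : ℝ)) :
    G * ((1 - g) * offFun (fun n => (ψq n : ℝ)) N ν u + g * offFun (fun n => (ψq n : ℝ)) N ν (u + a) - (ψq u : ℝ))
      ≤ T.Z G (G * (lmean N ν + a * g)) := by
  have hs3 : ∀ k, ν k ≠ 0 → k = 0 ∨ k = 4 ∨ k = 11 := fun k hk => by rcases hs k hk with h | h <;> omega
  have h11 : ν 11 = 0 := by by_contra hc; rcases hs 11 hc with h | h <;> omega
  exact leaf_three ψq y T fuel u a 0 4 11 hz (fun _ => hsg) (fun h => absurd h11 h) hw hgb0 hgb1 (by norm_num) (by norm_num) (by norm_num)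
    f0 fN f1 hs3 ⟨Or.inl h11, fun _ => hreg⟩ hy hyG hG1 hGx hx1 hxg hg1 hA

/-- **ONE ATOM** `{d}` (a point mass; dummy atoms `d+11`, `d+12`). [this work] -/
theorem leaf_one (ψq : ℕ → ℚ) (y : ℚ) (T : Tab) (fuel : ℕ) (u a d : ℕ) {N : ℕ} {ν : ℕ → ℝ}
    (hz : leafChk ψq y T fuel u a d (d + 11) (d + 12) Mode.zero = true)
    (hw : T.wf = true) (hgb0 : T.gb.getD 0 0 = y) (hgb1 : T.gb.getLast?.getD 0 = 1)
    (f0 : ∀ h, 0 ≤ ν h) (fN : ∀ h, N < h → ν h = 0) (f1 : ∑ h ∈ Finset.range (N + 1), ν h = 1)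
    (hs : ∀ k, ν k ≠ 0 → k = d) {x : ℝ}
    {G g : ℝ} (hy : 0 < y) (hyG : (y : ℝ) < G) (hG1 : G ≤ 1) (hGx : (y : ℝ) ≤ G * x) (hx1 : x < 1) (hxg : x ≤ g) (hg1 : g < 1)
    (hA : G * (lmean N ν + a * g) ≤ ((T.ab.getLast?.getD 0 : ℚ) : ℝ)) :
    G * ((1 - g) * offFun (fun n => (ψq n : ℝ)) N ν u + g * offFun (fun n => (ψq n : ℝ)) N ν (u + a) - (ψq u : ℝ))
      ≤ T.Z G (G * (lmean N ν + a * g)) := by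
  have hs3 : ∀ k, ν k ≠ 0 → k = d ∨ k = d + 11 ∨ k = d + 12 := fun k hk => Or.inl (hs k hk)
  have h11 : ν (d + 11) = 0 := by by_contra hc; have := hs _ hc; omega
  have h12 : ν (d + 12) = 0 := by by_contra hc; have := hs _ hc; omega
  exact leaf_three ψq y T fuel u a d (d + 11) (d + 12) hz (fun h => absurd h11 h) (fun h => absurd h12 h) hw hgb0 hgb1 (by omega) (by omega)
    (by omega) f0 fN f1 hs3 ⟨Or.inl h12, fun _ => Or.inl h11⟩ hy hyG hG1 hGx hx1 hxg hg1 hA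

end Tab
end LawDec
end Quant
end Summit.CriticalPhenomena.PercolationContinuityZ3.Theorems
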